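import Summits.ValiantsHypothesis.ValiantsHypothesis.Theorems.NewtonFramesTwoProductsFrameRungTwoCancelOneD

/-!
# Crux `TwoProducts` (stmt-5906), line `FrameRungTwo`: the both-supports branch of (IX) FOLLOWS from the OUT kernel, given an additive separation (Lemma P)

`…CancelOneD.lean` (p639956) left the `k = 2` layer resting on two 1-D kernels: `hOut1D` (window-factorization statement, real
letters) and `hCancel1D` (deep–deep cancellation).  This file proves LEMMA P of `Cruxes/TwoProducts/memo-IX-g4.md` §3 in the 1-D
model: `certificate_of_out1D_of_separation` — assume `hOut1D`; then at a common vertex `e` (S-word `a` demoting ≥ 4 letters, S'-word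
`u`, windows) the neighbour certificate `e + T' p = Σ w + y` EXISTS as soon as there are ADDITIVE letter weights `ψ, ψ'` that agree
at every light common point other than `e` (`Σ ψ(b) = Σ ψ'(c)`) but SEPARATE the two words of `e` (`Σ ψ(a) ≠ Σ ψ'(u)`).
Mechanism: perturb every letter `x ↦ x + tσψ(x)` (`σ = Σψ(a) − Σψ'(u)`); for all small `t > 0` (an explicit bound from finitely many
sign conditions, `exists_small_sign`) the perturbed families are again an instance of `hOut1D` — same words below `e`, `u` pushed to
the non-light side, `e` OUT — so a certificate exists for each `t`; finitely many certificate shapes and infinitely many `t`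
(pigeonhole on `K + 1` values) give one shape valid for two values of `t`, hence for `t = 0`.
Consequence: non-cancelling multiplicative weights (the hypotheses of `hCancel1D`) give a character of the universal group that is
non-trivial on the top relation; unless that relation is TORSION modulo the lower ones an additive separation exists and this file
applies — `hCancel1D` is needed only in the torsion case (none in ≈ 6·10⁴ deep–deep pairs, memo-IX-g4 §2); the depth of `u` is irrelevant.
Honest scope: a REDUCTION for ONE stub of a rung strictly below the crux `TwoProducts`; nothing here bears on `VP ≠ VNP`.
[ours; setting KPTT arXiv:1308.2286 §2, §5]
-/

set_option linter.dupNamespace false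

namespace Summit.ValiantsHypothesis.ValiantsHypothesis.Theorems.NewtonFramesTwoProducts.FrameRungTwoTrinomial

open scoped BigOperators Classical

noncomputable section

section LemmaP

variable {m : ℕ}

/-- Finitely many sign conditions survive a small perturbation: for a finite set of pairs `(A, B)` there is `κ > 0` such that
`A + tB` has the sign of `A ≠ 0` for all `0 < t < κ`. [folklore] -/
theorem exists_small_sign (C : Finset (ℝ × ℝ)) :
    ∃ κ : ℝ, 0 < κ ∧ ∀ p ∈ C, ∀ t : ℝ, 0 < t → t < κ →
      (0 < p.1 → 0 < p.1 + t * p.2) ∧ (p.1 < 0 → p.1 + t * p.2 < 0) := by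
  induction C using Finset.induction_on with
  | empty => exact ⟨1, one_pos, fun p hp => absurd hp (Finset.notMem_empty p)⟩
  | @insert q C hq ih =>
    obtain ⟨κ, hκ, hC⟩ := ih
    have hb : 0 < |q.2| + 1 := by positivity
    by_cases hq0 : q.1 = 0
    · refine ⟨κ, hκ, fun p hp t ht htκ => ?_⟩
      rcases Finset.mem_insert.1 hp with rfl | hp
      · exact ⟨fun h => absurd hq0 h.ne', fun h => absurd hq0 h.ne⟩
      · exact hC p hp t ht htκ
    · have hA : 0 < |q.1| := abs_pos.2 hq0
      refine ⟨min κ (|q.1| / (|q.2| + 1)), lt_min hκ (div_pos hA hb), fun p hp t ht htκ => ?_⟩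
      rcases Finset.mem_insert.1 hp with rfl | hp
      · have ht1 : t < |p.1| / (|p.2| + 1) := lt_of_lt_of_le htκ (min_le_right _ _)
        have htB : |t * p.2| < |p.1| := by
          rw [abs_mul, abs_of_pos ht]
          calc t * |p.2| ≤ t * (|p.2| + 1) := by nlinarith [abs_nonneg p.2]
            _ < |p.1| / (|p.2| + 1) * (|p.2| + 1) := mul_lt_mul_of_pos_right ht1 hb
            _ = |p.1| := div_mul_cancel₀ _ hb.ne'
        constructor
        · intro h
          rw [abs_of_pos h] at htB
          have := neg_abs_le (t * p.2)
          linarith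
        · intro h
          rw [abs_of_neg h] at htB
          have := le_abs_self (t * p.2)
          linarith
      · exact hC p hp t ht (lt_of_lt_of_le htκ (min_le_left _ _))

/-- Lifting a word of a coordinatewise image family. [folklore] -/
theorem lift_word' {α β : Type*} (S : Fin m → Finset α) (φ : Fin m → α → β) (b1 : Fin m → β)
    (h : ∀ j, b1 j ∈ (S j).image (φ j)) : ∃ b : Fin m → α, (∀ j, b j ∈ S j) ∧ ∀ j, φ j (b j) = b1 j := by
  choose b hb hbe using fun j => Finset.mem_image.1 (h j)
  exact ⟨b, hb, hbe⟩

/-- **Lemma P (1-D).**  Under the 1-D OUT kernel `hOut1D`, a common vertex with a deep S-word `a` and ANY S'-word `u`, admitting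
additive letter weights that agree at the light common points other than `e` and separate `a` from `u`, has the neighbour
certificate of (IX). [ours] -/
theorem certificate_of_out1D_of_separation
    (hOut1D : ∀ (S S' : Fin m → Finset ℝ) (e : ℝ) (T T' a : Fin m → ℝ),
      (∀ b c : Fin m → ℝ, (∀ j, b j ∈ S j) → (∀ j, c j ∈ S j) → ∑ j, b j = ∑ j, c j → b = c) →
      (∀ b c : Fin m → ℝ, (∀ j, b j ∈ S' j) → (∀ j, c j ∈ S' j) → ∑ j, b j = ∑ j, c j → b = c) →
      (∀ j, T j ∈ S j) → (∀ j, ∀ x ∈ S j, x ≤ T j) → (∀ j, T' j ∈ S' j) → (∀ j, ∀ x ∈ S' j, x ≤ T' j) →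
      (∀ j, a j ∈ S j) → ∑ j, a j = e → ∑ j, T j = ∑ j, T' j → e < ∑ j, T j →
      (∀ b : Fin m → ℝ, (∀ j, b j ∈ S j) → ∑ j, b j ≠ e → e ≤ ∑ j, b j →
        ∃ c : Fin m → ℝ, (∀ j, c j ∈ S' j) ∧ ∑ j, c j = ∑ j, b j) →
      (∀ c : Fin m → ℝ, (∀ j, c j ∈ S' j) → ∑ j, c j ≠ e → e ≤ ∑ j, c j →
        ∃ b : Fin m → ℝ, (∀ j, b j ∈ S j) ∧ ∑ j, b j = ∑ j, c j) →
      (∀ c : Fin m → ℝ, (∀ j, c j ∈ S' j) → ∑ j, c j ≠ e) →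
      4 ≤ (Finset.univ.filter fun i => a i ≠ T i).card →
      ∃ (w : Fin m → ℝ) (p : Fin m) (y : ℝ), (∀ i, w i ∈ S' i) ∧
        (Finset.univ.filter fun i => w i ≠ T' i).card ≤ 2 ∧ y ∈ S' p ∧ e + T' p = ∑ i, w i + y)
    (S S' : Fin m → Finset ℝ) (e : ℝ) (T T' a u : Fin m → ℝ) (ψ ψ' : Fin m → ℝ → ℝ)
    (hS : ∀ b c : Fin m → ℝ, (∀ j, b j ∈ S j) → (∀ j, c j ∈ S j) → ∑ j, b j = ∑ j, c j → b = c)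
    (hS' : ∀ b c : Fin m → ℝ, (∀ j, b j ∈ S' j) → (∀ j, c j ∈ S' j) → ∑ j, b j = ∑ j, c j → b = c)
    (hT : ∀ j, T j ∈ S j) (hTmax : ∀ j, ∀ x ∈ S j, x ≤ T j) (hT' : ∀ j, T' j ∈ S' j) (hTmax' : ∀ j, ∀ x ∈ S' j, x ≤ T' j)
    (ha : ∀ j, a j ∈ S j) (hae : ∑ j, a j = e) (hu : ∀ j, u j ∈ S' j) (hue : ∑ j, u j = e)
    (htop : ∑ j, T j = ∑ j, T' j) (hTe : e < ∑ j, T j)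
    (hwin : ∀ b : Fin m → ℝ, (∀ j, b j ∈ S j) → ∑ j, b j ≠ e → e ≤ ∑ j, b j →
      ∃ c : Fin m → ℝ, (∀ j, c j ∈ S' j) ∧ ∑ j, c j = ∑ j, b j)
    (hwin' : ∀ c : Fin m → ℝ, (∀ j, c j ∈ S' j) → ∑ j, c j ≠ e → e ≤ ∑ j, c j →
      ∃ b : Fin m → ℝ, (∀ j, b j ∈ S j) ∧ ∑ j, b j = ∑ j, c j)
    (h4 : 4 ≤ (Finset.univ.filter fun i => a i ≠ T i).card)
    (hcons : ∀ b c : Fin m → ℝ, (∀ j, b j ∈ S j) → (∀ j, c j ∈ S' j) → ∑ j, b j = ∑ j, c j →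
      ∑ j, b j ≠ e → e ≤ ∑ j, b j → ∑ j, ψ j (b j) = ∑ j, ψ' j (c j))
    (hsep : ∑ j, ψ j (a j) ≠ ∑ j, ψ' j (u j)) :
    ∃ (w : Fin m → ℝ) (p : Fin m) (y : ℝ), (∀ i, w i ∈ S' i) ∧
      (Finset.univ.filter fun i => w i ≠ T' i).card ≤ 2 ∧ y ∈ S' p ∧ e + T' p = ∑ i, w i + y := by
  set σ : ℝ := ∑ j, ψ j (a j) - ∑ j, ψ' j (u j) with hσ
  have hσ2 : 0 < σ * σ := mul_self_pos.2 (sub_ne_zero.2 hsep)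
  set Ψ : (Fin m → ℝ) → ℝ := fun b => ∑ j, ψ j (b j) with hΨ
  set Ψ' : (Fin m → ℝ) → ℝ := fun c => ∑ j, ψ' j (c j) with hΨ'
  set PS := Fintype.piFinset S with hPS
  set PS' := Fintype.piFinset S' with hPS'
  set Call : Finset (ℝ × ℝ) :=
    ((PS ×ˢ PS).image fun bb => (∑ j, bb.1 j - ∑ j, bb.2 j, σ * (Ψ bb.1 - Ψ bb.2))) ∪
    ((PS' ×ˢ PS').image fun cc => (∑ j, cc.1 j - ∑ j, cc.2 j, σ * (Ψ' cc.1 - Ψ' cc.2))) ∪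
    (PS.image fun b => (∑ j, b j - e, σ * (Ψ b - Ψ a))) ∪
    (PS'.image fun c => (∑ j, c j - e, σ * (Ψ' c - Ψ a))) ∪
    (Finset.univ.biUnion fun j => ((S j) ×ˢ (S j)).image fun xx => (xx.1 - xx.2, σ * (ψ j xx.1 - ψ j xx.2))) ∪
    (Finset.univ.biUnion fun j => ((S' j) ×ˢ (S' j)).image fun xx => (xx.1 - xx.2, σ * (ψ' j xx.1 - ψ' j xx.2)))
    with hCall
  obtain ⟨κ, hκ, hsign⟩ := exists_small_sign Call
  have memPS : ∀ b : Fin m → ℝ, (∀ j, b j ∈ S j) → b ∈ PS := fun b hb => by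
    rw [hPS]; exact Fintype.mem_piFinset.2 hb
  have memPS' : ∀ c : Fin m → ℝ, (∀ j, c j ∈ S' j) → c ∈ PS' := fun c hc => by
    rw [hPS']; exact Fintype.mem_piFinset.2 hc
  have m1 : ∀ b b' : Fin m → ℝ, (∀ j, b j ∈ S j) → (∀ j, b' j ∈ S j) →
      (∑ j, b j - ∑ j, b' j, σ * (Ψ b - Ψ b')) ∈ Call := fun b b' hb hb' => by
    rw [hCall]; simp only [Finset.mem_union]
    refine Or.inl (Or.inl (Or.inl (Or.inl (Or.inl ?_))))
    exact Finset.mem_image.2 ⟨(b, b'), Finset.mk_mem_product (memPS b hb) (memPS b' hb'), rfl⟩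
  have m2 : ∀ c c' : Fin m → ℝ, (∀ j, c j ∈ S' j) → (∀ j, c' j ∈ S' j) →
      (∑ j, c j - ∑ j, c' j, σ * (Ψ' c - Ψ' c')) ∈ Call := fun c c' hc hc' => by
    rw [hCall]; simp only [Finset.mem_union]
    refine Or.inl (Or.inl (Or.inl (Or.inl (Or.inr ?_))))
    exact Finset.mem_image.2 ⟨(c, c'), Finset.mk_mem_product (memPS' c hc) (memPS' c' hc'), rfl⟩
  have m3 : ∀ b : Fin m → ℝ, (∀ j, b j ∈ S j) → (∑ j, b j - e, σ * (Ψ b - Ψ a)) ∈ Call := fun b hb => by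
    rw [hCall]; simp only [Finset.mem_union]
    exact Or.inl (Or.inl (Or.inl (Or.inr (Finset.mem_image.2 ⟨b, memPS b hb, rfl⟩))))
  have m4 : ∀ c : Fin m → ℝ, (∀ j, c j ∈ S' j) → (∑ j, c j - e, σ * (Ψ' c - Ψ a)) ∈ Call := fun c hc => by
    rw [hCall]; simp only [Finset.mem_union]
    exact Or.inl (Or.inl (Or.inr (Finset.mem_image.2 ⟨c, memPS' c hc, rfl⟩)))
  have m5 : ∀ j, ∀ x ∈ S j, ∀ x' ∈ S j, (x - x', σ * (ψ j x - ψ j x')) ∈ Call := fun j x hx x' hx' => by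
    rw [hCall]; simp only [Finset.mem_union]
    refine Or.inl (Or.inr ?_)
    rw [Finset.mem_biUnion]
    exact ⟨j, Finset.mem_univ _, Finset.mem_image.2 ⟨(x, x'), Finset.mk_mem_product hx hx', rfl⟩⟩
  have m6 : ∀ j, ∀ x ∈ S' j, ∀ x' ∈ S' j, (x - x', σ * (ψ' j x - ψ' j x')) ∈ Call := fun j x hx x' hx' => by
    rw [hCall]; simp only [Finset.mem_union]
    refine Or.inr ?_
    rw [Finset.mem_biUnion]
    exact ⟨j, Finset.mem_univ _, Finset.mem_image.2 ⟨(x, x'), Finset.mk_mem_product hx hx', rfl⟩⟩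
  have hcert : ∀ t : ℝ, 0 < t → t < κ → ∃ (w : Fin m → ℝ) (p : Fin m) (y : ℝ), (∀ i, w i ∈ S' i) ∧
      (Finset.univ.filter fun i => w i ≠ T' i).card ≤ 2 ∧ y ∈ S' p ∧
      (e + T' p - ∑ i, w i - y) + t * (σ * (Ψ a + ψ' p (T' p) - Ψ' w - ψ' p y)) = 0 := by
    intro t ht htκ
    set τ : ℝ := t * σ with hτ
    set φ : Fin m → ℝ → ℝ := fun j x => x + τ * ψ j x with hφ
    set φ' : Fin m → ℝ → ℝ := fun j x => x + τ * ψ' j x with hφ'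
    have hφsum : ∀ b : Fin m → ℝ, ∑ j, φ j (b j) = ∑ j, b j + τ * Ψ b := fun b => by
      simp only [hφ, hΨ, Finset.sum_add_distrib, Finset.mul_sum]
    have hφ'sum : ∀ c : Fin m → ℝ, ∑ j, φ' j (c j) = ∑ j, c j + τ * Ψ' c := fun c => by
      simp only [hφ', hΨ', Finset.sum_add_distrib, Finset.mul_sum]
    have sgn : ∀ p ∈ Call, (0 < p.1 → 0 < p.1 + t * p.2) ∧ (p.1 < 0 → p.1 + t * p.2 < 0) :=
      fun p hp => hsign p hp t ht htκ
    have key : ∀ A B : ℝ, (A, B) ∈ Call → A ≠ 0 → A + t * B ≠ 0 := by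
      intro A B hAB hA0 h
      rcases lt_or_gt_of_ne hA0 with hl | hg
      · exact absurd h ((sgn _ hAB).2 hl).ne
      · exact absurd h ((sgn _ hAB).1 hg).ne'
    have hinj : ∀ j, ∀ x ∈ S j, ∀ x' ∈ S j, φ j x = φ j x' → x = x' := by
      intro j x hx x' hx' h
      by_contra hne
      have h1 : x - x' + t * (σ * (ψ j x - ψ j x')) ≠ 0 := key _ _ (m5 j x hx x' hx') (sub_ne_zero.2 hne)
      apply h1
      have : φ j x - φ j x' = 0 := sub_eq_zero.2 h
      simp only [hφ, hτ] at this
      linarith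
    have hinj' : ∀ j, ∀ x ∈ S' j, ∀ x' ∈ S' j, φ' j x = φ' j x' → x = x' := by
      intro j x hx x' hx' h
      by_contra hne
      have h1 : x - x' + t * (σ * (ψ' j x - ψ' j x')) ≠ 0 := key _ _ (m6 j x hx x' hx') (sub_ne_zero.2 hne)
      apply h1
      have : φ' j x - φ' j x' = 0 := sub_eq_zero.2 h
      simp only [hφ', hτ] at this
      linarith
    have hmono : ∀ j, ∀ x ∈ S j, ∀ x' ∈ S j, x ≤ x' → φ j x ≤ φ j x' := by
      intro j x hx x' hx' hle
      rcases hle.lt_or_eq with hlt | heq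
      · have h1 := (sgn _ (m5 j x hx x' hx')).2 (sub_neg.2 hlt)
        simp only [hφ, hτ]
        nlinarith [h1]
      · rw [heq]
    have hmono' : ∀ j, ∀ x ∈ S' j, ∀ x' ∈ S' j, x ≤ x' → φ' j x ≤ φ' j x' := by
      intro j x hx x' hx' hle
      rcases hle.lt_or_eq with hlt | heq
      · have h1 := (sgn _ (m6 j x hx x' hx')).2 (sub_neg.2 hlt)
        simp only [hφ', hτ]
        nlinarith [h1]
      · rw [heq]
    set S1 : Fin m → Finset ℝ := fun j => (S j).image (φ j) with hS1
    set S1' : Fin m → Finset ℝ := fun j => (S' j).image (φ' j) with hS1'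
    set e1 : ℝ := e + τ * Ψ a with he1
    have hae1 : ∑ j, φ j (a j) = e1 := by rw [hφsum, hae]
    have hS1d : ∀ b c : Fin m → ℝ, (∀ j, b j ∈ S1 j) → (∀ j, c j ∈ S1 j) → ∑ j, b j = ∑ j, c j → b = c := by
      intro b1 c1 hb1 hc1 hsum
      obtain ⟨b, hb, hbe⟩ := lift_word' S φ b1 hb1
      obtain ⟨c, hc, hce⟩ := lift_word' S φ c1 hc1
      have h1 : ∑ j, b j + τ * Ψ b = ∑ j, c j + τ * Ψ c := by
        rw [← hφsum, ← hφsum]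
        calc ∑ j, φ j (b j) = ∑ j, b1 j := Finset.sum_congr rfl fun j _ => hbe j
          _ = ∑ j, c1 j := hsum
          _ = ∑ j, φ j (c j) := Finset.sum_congr rfl fun j _ => (hce j).symm
      have h2 : ∑ j, b j = ∑ j, c j := by
        by_contra hne
        have h3 := key _ _ (m1 b c hb hc) (sub_ne_zero.2 hne)
        apply h3; rw [hτ] at h1; linarith
      have h4 : b = c := hS b c hb hc h2
      funext j; rw [← hbe j, ← hce j, h4]
    have hS1'd : ∀ b c : Fin m → ℝ, (∀ j, b j ∈ S1' j) → (∀ j, c j ∈ S1' j) → ∑ j, b j = ∑ j, c j → b = c := by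
      intro b1 c1 hb1 hc1 hsum
      obtain ⟨b, hb, hbe⟩ := lift_word' S' φ' b1 hb1
      obtain ⟨c, hc, hce⟩ := lift_word' S' φ' c1 hc1
      have h1 : ∑ j, b j + τ * Ψ' b = ∑ j, c j + τ * Ψ' c := by
        rw [← hφ'sum, ← hφ'sum]
        calc ∑ j, φ' j (b j) = ∑ j, b1 j := Finset.sum_congr rfl fun j _ => hbe j
          _ = ∑ j, c1 j := hsum
          _ = ∑ j, φ' j (c j) := Finset.sum_congr rfl fun j _ => (hce j).symm
      have h2 : ∑ j, b j = ∑ j, c j := by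
        by_contra hne
        have h3 := key _ _ (m2 b c hb hc) (sub_ne_zero.2 hne)
        apply h3; rw [hτ] at h1; linarith
      have h4 : b = c := hS' b c hb hc h2
      funext j; rw [← hbe j, ← hce j, h4]
    have hT1 : ∀ j, φ j (T j) ∈ S1 j := fun j => Finset.mem_image_of_mem _ (hT j)
    have hT1max : ∀ j, ∀ x ∈ S1 j, x ≤ φ j (T j) := by
      intro j x1 hx1
      obtain ⟨x, hx, rfl⟩ := Finset.mem_image.1 hx1
      exact hmono j x hx (T j) (hT j) (hTmax j x hx)
    have hT1' : ∀ j, φ' j (T' j) ∈ S1' j := fun j => Finset.mem_image_of_mem _ (hT' j)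
    have hT1max' : ∀ j, ∀ x ∈ S1' j, x ≤ φ' j (T' j) := by
      intro j x1 hx1
      obtain ⟨x, hx, rfl⟩ := Finset.mem_image.1 hx1
      exact hmono' j x hx (T' j) (hT' j) (hTmax' j x hx)
    have ha1 : ∀ j, φ j (a j) ∈ S1 j := fun j => Finset.mem_image_of_mem _ (ha j)
    have hTΨ : Ψ T = Ψ' T' :=
      hcons T T' hT hT' htop (fun h => by rw [h] at hTe; exact lt_irrefl _ hTe) hTe.le
    have htop1 : ∑ j, φ j (T j) = ∑ j, φ' j (T' j) := by rw [hφsum, hφ'sum, htop, hTΨ]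
    have hTe1 : e1 < ∑ j, φ j (T j) := by
      rw [hφsum, he1]
      have h1 := (sgn _ (m3 T hT)).1 (sub_pos.2 hTe)
      rw [hτ]; nlinarith [h1]
    have below : ∀ b : Fin m → ℝ, (∀ j, b j ∈ S j) → ∑ j, b j < e → ∑ j, b j + τ * Ψ b < e1 := by
      intro b hb hlt
      have h1 := (sgn _ (m3 b hb)).2 (sub_neg.2 hlt)
      rw [he1, hτ]; nlinarith [h1]
    have below' : ∀ c : Fin m → ℝ, (∀ j, c j ∈ S' j) → ∑ j, c j < e → ∑ j, c j + τ * Ψ' c < e1 := by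
      intro c hc hlt
      have h1 := (sgn _ (m4 c hc)).2 (sub_neg.2 hlt)
      rw [he1, hτ]; nlinarith [h1]
    have hu_below : ∑ j, u j + τ * Ψ' u < e1 := by
      rw [he1, hue, hτ]
      have : Ψ' u - Ψ a = -σ := by simp only [hσ, hΨ, hΨ']; ring
      nlinarith [hσ2, ht, this]
    have hwin1 : ∀ b : Fin m → ℝ, (∀ j, b j ∈ S1 j) → ∑ j, b j ≠ e1 → e1 ≤ ∑ j, b j →
        ∃ c : Fin m → ℝ, (∀ j, c j ∈ S1' j) ∧ ∑ j, c j = ∑ j, b j := by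
      intro b1 hb1 hne hge
      obtain ⟨b, hb, hbe⟩ := lift_word' S φ b1 hb1
      have hsum : ∑ j, b1 j = ∑ j, b j + τ * Ψ b := by
        rw [← hφsum]; exact Finset.sum_congr rfl fun j _ => (hbe j).symm
      rw [hsum] at hne hge
      have hgt : e < ∑ j, b j := by
        rcases lt_trichotomy (∑ j, b j) e with hlt | heq | hgt
        · exact absurd hge (not_le.2 (below b hb hlt))
        · exact absurd (by rw [hS b a hb ha (by rw [heq, hae]), hae, he1]) hne
        · exact hgt
      obtain ⟨c, hc, hcs⟩ := hwin b hb hgt.ne' hgt.le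
      have hΨc : Ψ b = Ψ' c := hcons b c hb hc hcs.symm hgt.ne' hgt.le
      refine ⟨fun j => φ' j (c j), fun j => Finset.mem_image_of_mem _ (hc j), ?_⟩
      rw [hsum, hφ'sum, hcs, hΨc]
    have hwin1' : ∀ c : Fin m → ℝ, (∀ j, c j ∈ S1' j) → ∑ j, c j ≠ e1 → e1 ≤ ∑ j, c j →
        ∃ b : Fin m → ℝ, (∀ j, b j ∈ S1 j) ∧ ∑ j, b j = ∑ j, c j := by
      intro c1 hc1 hne hge
      obtain ⟨c, hc, hce⟩ := lift_word' S' φ' c1 hc1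
      have hsum : ∑ j, c1 j = ∑ j, c j + τ * Ψ' c := by
        rw [← hφ'sum]; exact Finset.sum_congr rfl fun j _ => (hce j).symm
      rw [hsum] at hne hge
      have hgt : e < ∑ j, c j := by
        rcases lt_trichotomy (∑ j, c j) e with hlt | heq | hgt
        · exact absurd hge (not_le.2 (below' c hc hlt))
        · have hcu : c = u := hS' c u hc hu (by rw [heq, hue])
          rw [hcu] at hge
          exact absurd hge (not_le.2 hu_below)
        · exact hgt
      obtain ⟨b, hb, hbs⟩ := hwin' c hc hgt.ne' hgt.le
      have hΨb : Ψ b = Ψ' c := hcons b c hb hc hbs (by rw [hbs]; exact hgt.ne') (by rw [hbs]; exact hgt.le)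
      refine ⟨fun j => φ j (b j), fun j => Finset.mem_image_of_mem _ (hb j), ?_⟩
      rw [hsum, hφsum, hbs, hΨb]
    have hout1 : ∀ c : Fin m → ℝ, (∀ j, c j ∈ S1' j) → ∑ j, c j ≠ e1 := by
      intro c1 hc1 h
      obtain ⟨c, hc, hce⟩ := lift_word' S' φ' c1 hc1
      have hsum : ∑ j, c j + τ * Ψ' c = e1 := by
        rw [← hφ'sum, ← h]; exact Finset.sum_congr rfl fun j _ => hce j
      rcases lt_trichotomy (∑ j, c j) e with hlt | heq | hgt
      · exact absurd hsum (below' c hc hlt).ne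
      · have hcu : c = u := hS' c u hc hu (by rw [heq, hue])
        rw [hcu] at hsum
        exact absurd hsum hu_below.ne
      · have h1 := (sgn _ (m4 c hc)).1 (sub_pos.2 hgt)
        have h2 : ∑ j, c j - e + t * (σ * (Ψ' c - Ψ a)) = 0 := by rw [he1, hτ] at hsum; linarith
        exact absurd h2 h1.ne'
    have hfilt : (Finset.univ.filter fun i => φ i (a i) ≠ φ i (T i)) = (Finset.univ.filter fun i => a i ≠ T i) := by
      ext i
      simp only [Finset.mem_filter, Finset.mem_univ, true_and]
      exact ⟨fun h hc => h (by rw [hc]), fun h hc => h (hinj i _ (ha i) _ (hT i) hc)⟩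
    have h41 : 4 ≤ (Finset.univ.filter fun i => φ i (a i) ≠ φ i (T i)).card := by rw [hfilt]; exact h4
    obtain ⟨w1, p, y1, hw1, hw1c, hy1, hEq⟩ := hOut1D S1 S1' e1 (fun j => φ j (T j)) (fun j => φ' j (T' j))
      (fun j => φ j (a j)) hS1d hS1'd hT1 hT1max hT1' hT1max' ha1 hae1 htop1 hTe1 hwin1 hwin1' hout1 h41
    obtain ⟨w, hw, hwe⟩ := lift_word' S' φ' w1 hw1
    obtain ⟨y, hy, hye⟩ := Finset.mem_image.1 hy1
    refine ⟨w, p, y, hw, ?_, hy, ?_⟩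
    · have hfw : (Finset.univ.filter fun i => w i ≠ T' i) =
          (Finset.univ.filter fun i => w1 i ≠ φ' i (T' i)) := by
        ext i
        simp only [Finset.mem_filter, Finset.mem_univ, true_and]
        rw [← hwe i]
        exact ⟨fun h hc => h (hinj' i _ (hw i) _ (hT' i) hc), fun h hc => h (by rw [hc])⟩
      rw [hfw]; exact hw1c
    · have hsw : ∑ i, w1 i = ∑ i, w i + τ * Ψ' w := by
        rw [← hφ'sum]; exact Finset.sum_congr rfl fun j _ => (hwe j).symm
      rw [hsw, ← hye, he1] at hEq
      simp only [hφ'] at hEq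
      rw [hτ] at hEq
      linear_combination hEq
  obtain ⟨w0, p0, y0, -, -, -, -⟩ := hcert (κ / 2) (by linarith) (by linarith)
  set Cert := (PS' ×ˢ (Finset.univ : Finset (Fin m))) ×ˢ (Finset.univ.biUnion S') with hCert
  obtain ⟨K, hK⟩ : ∃ K : ℕ, Cert.card < K := ⟨Cert.card + 1, Nat.lt_succ_self _⟩
  set ts : Finset ℕ := Finset.range K with hts
  have hK1 : (0 : ℝ) < (K : ℝ) + 1 := by positivity
  have htpos : ∀ n : ℕ, 0 < κ * (n + 1) / (K + 1) := fun n =>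
    div_pos (mul_pos hκ (by positivity)) hK1
  have htlt : ∀ n ∈ ts, κ * (n + 1) / (K + 1) < κ := by
    intro n hn
    rw [hts, Finset.mem_range] at hn
    have h1 : ((n : ℝ) + 1) < (K : ℝ) + 1 := by exact_mod_cast Nat.succ_lt_succ hn
    rw [div_lt_iff₀ hK1]
    nlinarith [hκ, h1]
  have hch : ∀ n : ℕ, ∃ c : ((Fin m → ℝ) × Fin m) × ℝ, n ∈ ts → (∀ i, c.1.1 i ∈ S' i) ∧
      (Finset.univ.filter fun i => c.1.1 i ≠ T' i).card ≤ 2 ∧ c.2 ∈ S' c.1.2 ∧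
      (e + T' c.1.2 - ∑ i, c.1.1 i - c.2) +
        (κ * (n + 1) / (K + 1)) * (σ * (Ψ a + ψ' c.1.2 (T' c.1.2) - Ψ' c.1.1 - ψ' c.1.2 c.2)) = 0 := by
    intro n
    by_cases hn : n ∈ ts
    · obtain ⟨w, p, y, hw, hwc, hy, hEq⟩ := hcert _ (htpos n) (htlt n hn)
      exact ⟨((w, p), y), fun _ => ⟨hw, hwc, hy, hEq⟩⟩
    · exact ⟨((w0, p0), y0), fun h => absurd h hn⟩
  choose cert hcertp using hch
  have hmaps : ∀ n ∈ ts, cert n ∈ Cert := by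
    intro n hn
    obtain ⟨hw, -, hy, -⟩ := hcertp n hn
    rw [hCert]
    refine Finset.mk_mem_product (Finset.mk_mem_product (memPS' _ hw) (Finset.mem_univ _)) ?_
    rw [Finset.mem_biUnion]; exact ⟨_, Finset.mem_univ _, hy⟩
  have hcard : Cert.card < ts.card := by rw [hts, Finset.card_range]; exact hK
  obtain ⟨n, hn, n', hn', hne, heq⟩ := Finset.exists_ne_map_eq_of_card_lt_of_maps_to hcard hmaps
  obtain ⟨hw, hwc, hy, hE⟩ := hcertp n hn
  obtain ⟨-, -, -, hE'⟩ := hcertp n' hn'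
  rw [← heq] at hE'
  set A : ℝ := e + T' (cert n).1.2 - ∑ i, (cert n).1.1 i - (cert n).2 with hA
  set B : ℝ := σ * (Ψ a + ψ' (cert n).1.2 (T' (cert n).1.2) - Ψ' (cert n).1.1 - ψ' (cert n).1.2 (cert n).2) with hB
  have hnn : (n : ℝ) ≠ (n' : ℝ) := by exact_mod_cast hne
  have hA0 : A = 0 := by
    have h1 : A + κ * (n + 1) / (K + 1) * B = 0 := hE
    have h2 : A + κ * (n' + 1) / (K + 1) * B = 0 := hE'
    have h3 : κ * ((n : ℝ) - n') / (K + 1) * B = 0 := by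
      have : κ * ((n : ℝ) - n') / (K + 1) * B = (A + κ * (n + 1) / (K + 1) * B) - (A + κ * (n' + 1) / (K + 1) * B) := by
        ring
      rw [this, h1, h2, sub_zero]
    have hB0 : B = 0 := by
      rcases mul_eq_zero.1 h3 with h | h
      · exfalso
        rw [div_eq_zero_iff] at h
        rcases h with h | h
        · rcases mul_eq_zero.1 h with h | h
          · exact hκ.ne' h
          · exact hnn (sub_eq_zero.1 h)
        · exact hK1.ne' h
      · exact h
    rw [hB0, mul_zero, add_zero] at h1
    exact h1
  refine ⟨(cert n).1.1, (cert n).1.2, (cert n).2, hw, hwc, hy, ?_⟩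
  rw [hA] at hA0
  linarith

end LemmaP

end

end Summit.ValiantsHypothesis.ValiantsHypothesis.Theorems.NewtonFramesTwoProducts.FrameRungTwoTrinomial
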